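import Summits.Ventures.PercRepro.Night2OneFatColumnZero
import Summits.Ventures.PercRepro.Night2LocalRuleGoodTwo

/-!
# PercRepro — the case-0 column bound transfers to the distance-2 fallback (night-2, gen 29)

At a coloop-free target `S` the shares of `dshGT2` and `dshGT` coincide: in the good case they are the same formula;
in the fallback cases both vanish — a distance-2 fallback target has a coloop (`exists_mem_coloops_of_d2Target`) and so
has a missed-point fallback target (`exists_mem_coloops_of_missedTarget`: a missed point that is not good lies in the
closure of another face, whose coloop stays a coloop).  Hence `dload` agrees and **`dload_gt2_le_cap2_of_no_coloops`**
follows from `dload_gt_le_cap2_of_no_coloops`.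
-/

namespace PercRepro.Shadow

open Finset PerFlat ThmH

variable {α : Type*} [DecidableEq α] {M : Matroid α} [M.Finite] {G : Finset α}

section ColumnZeroTwo

open scoped Classical in
/-- **A missed-point target of a lossy big pair without good points has a coloop off `K`.** -/
theorem exists_mem_coloops_of_missedTarget (hG : G ∈ flatsQ M (5 + 1)) (hd : (gr M \ G).card = 2)
    (hk : kColoops M G = 1) (hs : ∀ e ∈ gr M, ∀ f ∈ gr M, e ≠ f → rkN M {e, f} = 2)
    (hl : ∀ e ∈ gr M, M.Indep {e}) {B : Finset α} (hB : B ∈ thinMembers M 5 G)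
    (hbig : 5 ≤ (B \ coloops M G).card) {z : α} (hz : z ∈ G \ clF M B) (hl0 : loss M 5 G B z ≠ 0)
    (hno : ¬ (gtPts M 5 G (insert z B)).Nonempty) {S : Finset α} (hS : S ∈ missedTargets M G B z) :
    ∃ w, w ∈ coloops M (S \ coloops M G) := by
  have hd' : (gr M \ G).card ≤ 5 := by omega
  obtain ⟨hC3, hImg, -, -⟩ := three_thin_faces_of_loss_ne_zero hG hd hk hs hl hB hbig hz hl0
  set Q := insert z B with hQ
  have hB' : B ∈ membersIn M (Uq M (5 + 2) 5) G := (mem_thinMembers.1 hB).1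
  have hBU : B ∈ Uq M (5 + 2) 5 := (mem_membersIn.1 hB').1
  have hBg : B ⊆ gr M := (mem_Uq.1 hBU).1
  have hBG : B ⊆ G := (subset_clF hBU).trans (mem_membersIn.1 hB').2
  have hQG : Q ⊆ G := Finset.insert_subset (Finset.mem_sdiff.1 hz).1 hBG
  have hQ5 : rkN M (Q \ coloops M G) = 5 := rkN_insert_sdiff_coloops_eq_five_of_thin hG hd hk hB hz
  have hKB : coloops M G ⊆ B := coloops_subset_of_mem_thinMembers hG hd' hB
  obtain ⟨x, hx, hxz, rfl⟩ := mem_missedTargets.1 hS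
  have hxQ : x ∉ Q := by
    rw [hQ, Finset.mem_insert, not_or]
    exact ⟨hxz, notMem_of_mem_sdiff_clF' hBg hx⟩
  have hxG : x ∈ G \ Q := Finset.mem_sdiff.2 ⟨(Finset.mem_sdiff.1 hx).1, hxQ⟩
  have hxK : x ∈ G \ coloops M G := by
    refine Finset.mem_sdiff.2 ⟨(Finset.mem_sdiff.1 hx).1, fun h => hxQ ?_⟩
    exact Finset.mem_insert_of_mem (hKB h)
  -- `x` is not good: it lies in the closures of at least two faces, in particular of some face at a coloop `w`
  have hnotgood : ¬ ((thinFacesOf M 5 G Q).filter (fun F => x ∈ clF M F)).card ≤ 1 := by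
    intro h1
    exact hno ⟨x, mem_goodPts.2 ⟨hxG, h1⟩⟩
  push Not at hnotgood
  unfold thinFacesOf at hnotgood
  rw [hImg] at hnotgood
  obtain ⟨F, hF⟩ := Finset.card_pos.1 (by omega : 0 < (((coloops M (Q \ coloops M G)).image
    (fun w => Q.erase w)).filter (fun F => x ∈ clF M F)).card)
  rw [Finset.mem_filter, Finset.mem_image] at hF
  obtain ⟨⟨w, hw, rfl⟩, hxw⟩ := hF
  have hthin : Q.erase w ∈ thinMembers M 5 G := by
    have : Q.erase w ∈ (coverPreimages M (Uq M (5 + 2) 5) G Q).filter (fun F => F ∉ lay0 M 5 G) := by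
      rw [hImg, Finset.mem_image]; exact ⟨w, hw, rfl⟩
    rw [Finset.mem_filter, mem_coverPreimages] at this
    exact mem_thinMembers.2 ⟨this.1.1, this.2⟩
  exact ⟨w, mem_coloops_insert_of_mem_clF hG hd hk hQG hQ5 hw hthin hxK hxQ hxw⟩

open scoped Classical in
/-- At a coloop-free target the two rules' shares of a thin big pair coincide. -/
theorem dshGT2_eq_dshGT_of_no_coloops (hG : G ∈ flatsQ M (5 + 1)) (hd : (gr M \ G).card = 2)
    (hk : kColoops M G = 1) (hs : ∀ e ∈ gr M, ∀ f ∈ gr M, e ≠ f → rkN M {e, f} = 2)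
    (hl : ∀ e ∈ gr M, M.Indep {e}) {B : Finset α} (hB : B ∈ thinMembers M 5 G)
    (hbig : 5 ≤ (B \ coloops M G).card) {z : α} (hz : z ∈ G \ clF M B) {S : Finset α}
    (hc : coloops M (S \ coloops M G) = ∅) : dshGT2 M 5 G B z S = dshGT M 5 G B z S := by
  by_cases hl0 : loss M 5 G B z = 0
  · unfold dshGT2 dshGT dshMissed
    rw [hl0]
    simp only [zero_div, ite_self]
  unfold dshGT2 dshGT
  by_cases hne : (gtPts M 5 G (insert z B)).Nonempty
  · simp only [if_pos hne]
  · simp only [if_neg hne]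
    by_cases hne2 : (d2Targets M 5 G (insert z B)).Nonempty
    · simp only [if_pos hne2]
      have hS2 : S ∉ d2Targets M 5 G (insert z B) := by
        intro hS
        obtain ⟨w, hw⟩ := exists_mem_coloops_of_d2Target hG hd hk hs hl hB hbig hz hl0 hne hS
        rw [hc] at hw
        exact Finset.notMem_empty _ hw
      rw [if_neg hS2]
      unfold dshMissed
      rw [if_neg]
      intro hS
      obtain ⟨w, hw⟩ := exists_mem_coloops_of_missedTarget hG hd hk hs hl hB hbig hz hl0 hne hS
      rw [hc] at hw
      exact Finset.notMem_empty _ hw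
    · simp only [if_neg hne2]

open scoped Classical in
/-- At a coloop-free target the loads of the two rules coincide. -/
theorem dload_gt2_eq_dload_gt_of_no_coloops (hG : G ∈ flatsQ M (5 + 1)) (hd : (gr M \ G).card = 2)
    (hk : kColoops M G = 1) (hs : ∀ e ∈ gr M, ∀ f ∈ gr M, e ≠ f → rkN M {e, f} = 2)
    (hl : ∀ e ∈ gr M, M.Indep {e}) {S : Finset α} (hc : coloops M (S \ coloops M G) = ∅) :
    dload M 5 G (bigP M G) (dshGT2 M 5 G) S = dload M 5 G (bigP M G) (dshGT M 5 G) S := by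
  unfold dload
  apply Finset.sum_congr rfl
  intro B hB
  rw [Finset.mem_filter] at hB
  apply Finset.sum_congr rfl
  intro z hz
  exact dshGT2_eq_dshGT_of_no_coloops hG hd hk hs hl hB.1 hB.2 hz hc

open scoped Classical in
/-- **THE CASE-0 COLUMN BOUND FOR THE DISTANCE-2 FALLBACK** (cell `(2, 1)`, at most one fat closure). -/
theorem dload_gt2_le_cap2_of_no_coloops (hG : G ∈ flatsQ M (5 + 1)) (hd : (gr M \ G).card = 2)
    (hk : kColoops M G = 1) (hs : ∀ e ∈ gr M, ∀ f ∈ gr M, e ≠ f → rkN M {e, f} = 2)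
    (hl : ∀ e ∈ gr M, M.Indep {e}) (hfat : (fatClosures M 5 G 2).card ≤ 1) {S : Finset α} (hSG : S ⊆ G)
    (hc : coloops M (S \ coloops M G) = ∅) :
    dload M 5 G (bigP M G) (dshGT2 M 5 G) S ≤ cap2 M 5 G S := by
  rw [dload_gt2_eq_dload_gt_of_no_coloops hG hd hk hs hl hc]
  exact dload_gt_le_cap2_of_no_coloops hG hd hk hs hl hfat hSG hc

end ColumnZeroTwo

end PercRepro.Shadow
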